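import Summits.BirchSwinnertonDyer.BirchSwinnertonDyer.Theorems.PrintCf2RubinValueTwoKatzJZeroUniqueCells
import Summits.BirchSwinnertonDyer.BirchSwinnertonDyer.Theorems.PrintCf2RubinValueTwoAvatarOnRayExact
import Literature.NumberTheory.EllipticCurves.ProfiniteGroupDistributionPushforwardPadic
import Literature.NumberTheory.EllipticCurves.ProfiniteGroupDistributionFourier
import Literature.NumberTheory.GaloisRepresentations.FiniteGaloisCharacterPadicAvatar
import Literature.NumberTheory.EllipticCurves.DeShalit1987.LMeasureAvatarRigidity
import Literature.NumberTheory.EllipticCurves.DeShalit1987.KatzMeasurePointTransport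
import Literature.NumberTheory.EllipticCurves.DeShalit1987.RayClassTowerDiagonalSplit
import Literature.NumberTheory.GaloisRepresentations.HeckeCharacterInfinityTypeNormTwistProofs
import HarnessLib

/-!
# Uniqueness of the `j = 0` Katz–de Shalit measure on `Γ_K`, II: two bounded distributions along the
# same tower with the same `(m, 0)`-integrals, `m ≥ m₀`, COINCIDE (de Shalit 1987, II.4.12 Remark (iv) /
# II Thm. 4.14: "the measure … is unique")

Cell `bsd-print-cf2`, width seat `bsd-line-cf2-p1-w5` g15; lane of the print leaf `KatzDistributionsAtTwoPrint`
(stmt-BirchSwinnertonDyer-24720); planner (T4) clause 1 / LEAD card `katz_measure_two.md` v2.2 brick 2, assembling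
brick 1 + 1b (LEAD g17), 2α (`FiniteGaloisCharacterPadicAvatar`), 2β (`ProfiniteGroupDistributionFourier`),
2γ (`ProfiniteGroupDistributionPushforwardPadic`), A2 (`…AvatarOnRayExact`) and I (`…KatzJZeroUniqueCells`).
Theorems only; no `sorry`; nothing is closed by this file; no summit statement is proved; BSD is not proved.

SETTING: `K` totally complex with ONE infinite place `w₀`, `v` of degree one above `p` = the place of
`ι⁻¹ ∘ σ_{w₀}`, `v̄ ∋ p` another place, `S` finite with `v ∉ S`; an auxiliary modulus `𝔪₀ ≠ 0` (`v ∤ 𝔪₀`,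
`w_{𝔪₀} = 1`, supported on `S ∪ {v̄}`); for every `j ≥ m₀` a Hecke character `ψ_j` of type `(−j, 0)` with module
of definition `≤ 𝔪₀`, unramified outside `S ∪ {v̄}` (all supplied from ONE `φ₀` of type `(−1,0)` by the sequel
`…KatzJZeroUniqueSupply.lean`); a tower `𝒰` of OPEN subgroups of `Γ_K` with `⋂ U_n ⊆ rayKer K p S`.

* §1 ★ `integral_ite_mem_mul_avatar_eq_zero` — if `ν` kills the avatar of every in-range `ε`, then
  `∫ 𝟙_{τ·Gal(K̄/K(𝔣′))}·r_j dν = 0` (Fourier on `Gal(K(𝔣′)/K)`: 2α + `mul_twist_outside` + 2β);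
* §2 ★ `integral_ite_mem_absRayAdicTower_eq_zero` — `∫ 𝟙_{τ·Gal(K̄/K(𝔣′v^{n+1}))} dν = 0` (localise: on
  `τ·Gal(K̄/K(𝔪₀))`, `r_j(σ) = r_j(τ)·(e(κ_v(τ⁻¹σ)))^{−j}` exactly by A2; 2γ = brick 1 on the coordinate `z_τ`);
* §3 ★★ `μ_eq_zero_of_forall_integral_avatar_eq_zero` (`rayKer ≤ U_n`, `v·v̄ ⊆ (p)`: every cell is a union of
  such cosets, I §2); §4 ★★★ `μ_eq_of_forall_integral_avatar_eq`, `μ_eq_of_forall_identity` — **two bounded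
  distributions along `𝒰` with the same in-range integrals (resp. the same `(m,0)`-identities `∀ hL, ∫ ê = R ε m hL`,
  any right-hand side `R`, `m₀ ≥ 1`) are EQUAL on every cell.**

## References

* [deShalit1987] E. de Shalit, *Iwasawa theory of elliptic curves with complex multiplication* (1987), II.4.12
  Remark (iv) (p. 67), II Thm. 4.14 (p. 71), II.4.16–4.17 (p. 76–78); [Washington1997] L. C. Washington, §7.2, Lemma 4.7.
-/

noncomputable section

namespace Summit.BirchSwinnertonDyer.BirchSwinnertonDyer.Theorems.PrintCf2.KatzJZeroUnique

open scoped NumberField Topology Classical nonZeroDivisors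
open NumberField IsDedekindDomain IsDedekindDomain.HeightOneSpectrum Field Filter Polynomial
open Literature.NumberTheory.EllipticCurves Literature.NumberTheory.GaloisRepresentations
open Literature.NumberTheory.NumberFields
open Summit.BirchSwinnertonDyer.BirchSwinnertonDyer.Theorems.PrintCf2.AvatarOnRay

set_option linter.dupNamespace false -- D-0017: single-problem summit, `…BirchSwinnertonDyer.BirchSwinnertonDyer…` repeats a namespace by design
set_option autoImplicit false
variable {p : ℕ} [hp : Fact p.Prime] {K : Type} [Field K] [NumberField K] [IsTotallyComplex K]

omit [IsTotallyComplex K] in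
/-- An algebraic Hecke character has a `p`-adic avatar (Weil). [cite: Weil1956, §1–§2] [cite: SerreAbelianLadic1968, Ch. II §2.7] -/
theorem exists_isPAdicAvatarOf (ι : PadicAlgCl p ≃+* ℂ) {φ : HeckeCharacter K} {pp qq : InfinitePlace K → ℤ}
    (hinf : φ.HasInfinityType pp qq) : ∃ r : FramedGaloisRep K (PadicAlgCl p) 1, IsPAdicAvatarOf ι φ r := by
  have hφ : φ.IsAlgebraic := (φ.isAlgebraic_iff_exists_hasInfinityType).mpr ⟨_, _, hinf⟩
  obtain ⟨r₀, hr₀⟩ := hφ.exists_lAdic ι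
  exact ⟨r₀, fun w hw hu ↦ ⟨(hr₀ w hw hu).1, by have h := (hr₀ w hw hu).2; rwa [map_inv₀] at h⟩⟩

section Core

variable (ι : PadicAlgCl p ≃+* ℂ) {v vbar : HeightOneSpectrum (𝓞 K)} {S : Finset (HeightOneSpectrum (𝓞 K))}
  (hvbar : ((p : ℕ) : 𝓞 K) ∈ vbar.asIdeal)
  {𝒰 : SubgroupTower (absoluteGaloisGroup K)} (hopen : ∀ n, IsOpen (𝒰.U n : Set (absoluteGaloisGroup K)))
  (hray : ⋂ n, (𝒰.U n : Set (absoluteGaloisGroup K)) ⊆ DeShalit1987.rayKer K p S)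
  (ν : GroupDistribution 𝒰 ℂ_[p]) (m₀ : ℕ)
  (hν : ∀ (ε : HeckeCharacter K) (e : FramedGaloisRep K (PadicAlgCl p) 1) (m : ℕ),
    IsPAdicAvatarOutside S ι ε e → m₀ ≤ m →
    ε.HasInfinityType (fun _ ↦ -(m : ℤ)) (fun _ ↦ ((0 : ℕ) : ℤ)) →
    (∀ w : HeightOneSpectrum (𝓞 K), w ∉ S → w ≠ vbar → ε.IsUnramifiedAt w) →
    𝒰.IsTowerContinuous (fun σ ↦ avatarValueAt e σ) →
    ν.integral (fun σ ↦ avatarValueAt e σ) = 0)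

/-! ### §1. Fourier: the indicator of a coset of `Gal(K̄/K(𝔣′))` times an in-range avatar integrates to zero -/

omit [IsTotallyComplex K] in
include hvbar hopen hray hν in
/-- ★ **`∫ 𝟙_{τ·Gal(K̄/K(𝔣′))}·r dν = 0`** for `𝔣′ ≠ 0` supported on `S ∪ {v̄}`, `τ ∈ Γ_K`, and `r` the avatar of
a Hecke character `ψ` of type `(−j, 0)`, `j ≥ m₀`, unramified outside `S ∪ {v̄}`: every character `χ` of
`Gal(K(𝔣′)/K)` gives an in-range `ω_{χ⁻¹}·ψ` with avatar `r ⊗ det(χ∘res)` (2α), whose integral vanishes; then 2β.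
[cite: deShalit1987, II.4.12 Remark (iv) (p. 67), II.5.2 (3)–(4) (p. 79–80)] -/
theorem integral_ite_mem_mul_avatar_eq_zero {𝔣' : Ideal (𝓞 K)} (h𝔣' : 𝔣' ≠ ⊥)
    (hsupp' : ∀ w : HeightOneSpectrum (𝓞 K), 𝔣' ≤ w.asIdeal → w ∈ S ∨ w = vbar)
    {ψ : HeckeCharacter K} {j : ℕ} (hj : m₀ ≤ j)
    (hψinf : ψ.HasInfinityType (fun _ ↦ -(j : ℤ)) (fun _ ↦ ((0 : ℕ) : ℤ)))
    (hψunr : ∀ w : HeightOneSpectrum (𝓞 K), w ∉ S → w ≠ vbar → ψ.IsUnramifiedAt w)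
    {r : FramedGaloisRep K (PadicAlgCl p) 1} (hr : IsPAdicAvatarOf ι ψ r) (τ : absoluteGaloisGroup K) :
    ν.integral (fun σ ↦ (if τ⁻¹ * σ ∈ (absRestrictNormalHom (rayClassField K 𝔣')).ker then (1 : ℂ_[p]) else 0) *
      avatarValueAt r σ) = 0 := by
  -- the quotient `Q = Gal(K(𝔣′)/K)` and the restriction `π`
  set π := absRestrictNormalHom (rayClassField K 𝔣') with hπ
  haveI : NeZero (Monoid.exponent (rayClassField K 𝔣' ≃ₐ[K] rayClassField K 𝔣')) :=
    ⟨Monoid.exponent_ne_zero_of_finite⟩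
  -- `S`-support of `𝔣′` away from `p`
  have hS' : ∀ w : HeightOneSpectrum (𝓞 K), w ∉ S → ((p : ℕ) : 𝓞 K) ∉ w.asIdeal → ¬ 𝔣' ≤ w.asIdeal := by
    intro w hwS hwp hle
    rcases hsupp' w hle with h | h
    · exact hwS h
    · exact hwp (h ▸ hvbar)
  -- `π` is constant on some level `U_N` (its kernel is open and contains `rayKer`)
  have hrayG : (DeShalit1987.rayKer K p S : Set (absoluteGaloisGroup K)) ⊆ π.ker :=
    SetLike.coe_subset_coe.mpr (DeShalit1987.rayKer_le_ker_absRestrictNormalHom_rayClassField p S h𝔣' hS')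
  obtain ⟨N, hN⟩ := 𝒰.exists_subset_of_isOpen hopen hray (isOpen_ker_absRestrictNormalHom _) hrayG
  have hNπ : ∀ σ σ' : absoluteGaloisGroup K, 𝒰.proj N σ = 𝒰.proj N σ' → π σ = π σ' := by
    intro σ σ' h
    have hmem : σ⁻¹ * σ' ∈ π.ker := hN (𝒰.proj_eq_iff.mp h)
    rw [MonoidHom.mem_ker, map_mul, map_inv, inv_mul_eq_one] at hmem
    exact hmem
  -- `r` is tower-continuous and of norm one
  have hψunr' : ∀ w : HeightOneSpectrum (𝓞 K), w ∉ S → ((p : ℕ) : 𝓞 K) ∉ w.asIdeal → ψ.IsUnramifiedAt w :=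
    fun w hwS hwp ↦ hψunr w hwS fun h ↦ hwp (h ▸ hvbar)
  have hrc : 𝒰.IsTowerContinuous (fun σ ↦ avatarValueAt r σ) :=
    DeShalit1987.isTowerContinuous_avatarValueAt (hr.isPAdicAvatarOutside S) hψunr' hopen hray
  -- Fourier inversion under the integral
  have key := ν.integral_ite_comp_mul_eq_zero_of_forall_monoidHom_units π hNπ
    (algebraMap (PadicAlgCl p) ℂ_[p]) hrc (M := 1) (fun σ ↦ (norm_avatarValueAt_eq_one r σ).le)
    (fun χ ↦ ?_) (π τ)
  · -- `π σ = π τ ⟺ τ⁻¹σ ∈ ker π`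
    refine (ν.integral_congr fun σ ↦ ?_).trans key
    have hiff : τ⁻¹ * σ ∈ π.ker ↔ π σ = π τ := by
      rw [MonoidHom.mem_ker, map_mul, map_inv, inv_mul_eq_one, eq_comm]
    simp only [hiff]
  · -- each character: `ω_{χ⁻¹}·ψ` is in range with avatar `r ⊗ det(χ ∘ res)`
    set ω : HeckeCharacter K := padicCharHecke (rayClassField K 𝔣') ι χ⁻¹ with hω
    have hl : IsPAdicAvatarOutside S ι ω (inflateCharacterPadic (rayClassField K 𝔣') χ) := by
      have h := isPAdicAvatarOutside_padicCharHecke_rayClassField (p := p) h𝔣' ι χ⁻¹ S hS'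
      have hχ : χ⁻¹⁻¹ = χ := MonoidHom.ext fun x ↦ by rw [MonoidHom.inv_apply, MonoidHom.inv_apply, inv_inv]
      rwa [hχ] at h
    have hωunr : ∀ w : HeightOneSpectrum (𝓞 K), ¬ 𝔣' ≤ w.asIdeal → ω.IsUnramifiedAt w :=
      fun w hw ↦ padicCharHecke_rayClassField_isUnramifiedAt h𝔣' ι χ⁻¹ hw
    have hav : IsPAdicAvatarOutside S ι (ω * ψ)
        (FramedRep.twist r (detChar (inflateCharacterPadic (rayClassField K 𝔣') χ))) :=
      hr.mul_twist_outside hl fun w hwS hwp ↦ hωunr w (hS' w hwS hwp)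
    have hinf : (ω * ψ).HasInfinityType (fun _ ↦ -(j : ℤ)) (fun _ ↦ ((0 : ℕ) : ℤ)) := by
      have h := (padicCharHecke_hasInfinityType_zero (rayClassField K 𝔣') ι χ⁻¹).mul' hψinf
      have e1 : ((fun _ ↦ (0 : ℤ)) + fun _ ↦ -(j : ℤ) : InfinitePlace K → ℤ) = fun _ ↦ -(j : ℤ) := by
        funext w; simp
      have e2 : ((fun _ ↦ (0 : ℤ)) + fun _ ↦ ((0 : ℕ) : ℤ) : InfinitePlace K → ℤ) = fun _ ↦ ((0 : ℕ) : ℤ) := by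
        funext w; simp
      rwa [e1, e2] at h
    have hunr : ∀ w : HeightOneSpectrum (𝓞 K), w ∉ S → w ≠ vbar → (ω * ψ).IsUnramifiedAt w := by
      intro w hwS hwv
      refine (hωunr w fun hle ↦ ?_).mul' (hψunr w hwS hwv)
      rcases hsupp' w hle with h | h
      · exact hwS h
      · exact hwv h
    have hunr' : ∀ w : HeightOneSpectrum (𝓞 K), w ∉ S → ((p : ℕ) : 𝓞 K) ∉ w.asIdeal → (ω * ψ).IsUnramifiedAt w :=
      fun w hwS hwp ↦ hunr w hwS fun h ↦ hwp (h ▸ hvbar)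
    have htc : 𝒰.IsTowerContinuous (fun σ ↦ avatarValueAt
        (FramedRep.twist r (detChar (inflateCharacterPadic (rayClassField K 𝔣') χ))) σ) :=
      DeShalit1987.isTowerContinuous_avatarValueAt hav hunr' hopen hray
    have h0 := hν (ω * ψ) _ j hav hj hinf hunr htc
    rw [← h0]
    refine ν.integral_congr fun σ ↦ ?_
    rw [avatarValueAt_twist_detChar, avatarValueAt_inflateCharacterPadic, PadicComplex.coe_eq]

/-! ### §2. Localise: the `v`-ray cosets `τ·Gal(K̄/K(𝔣′v^{n+1}))` integrate to zero -/

variable [v.asIdeal.LiesOver (ratPlace p).asIdeal]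
  (he : v.asIdeal.ramificationIdx (𝓞 ℚ) = 1) (hf : v.asIdeal.inertiaDeg (𝓞 ℚ) = 1)
  (hvp : ((p : ℕ) : 𝓞 K) ∈ v.asIdeal) {w₀ : InfinitePlace K} (hw₀ : ∀ w : InfinitePlace K, w = w₀)
  (hιv : ∀ d : 𝓞 K, d ∈ v.asIdeal ↔ ‖ι.symm (w₀.embedding (d : K))‖ < 1)
  {𝔪₀ : Ideal (𝓞 K)} (h𝔪₀ : 𝔪₀ ≠ ⊥) (hv𝔪₀ : ¬ 𝔪₀ ≤ v.asIdeal)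
  (hw𝔪₀ : ∀ u : (𝓞 K)ˣ, (u : 𝓞 K) - 1 ∈ 𝔪₀ → u = 1)
  (hsupp : ∀ w : HeightOneSpectrum (𝓞 K), 𝔪₀ ≤ w.asIdeal → w ∈ S ∨ w = vbar)
  (hψ : ∀ j : ℕ, m₀ ≤ j → ∃ (ψ : HeckeCharacter K) (T : Finset (HeightOneSpectrum (𝓞 K)))
      (em : HeightOneSpectrum (𝓞 K) → ℕ),
    ψ.HasInfinityType (fun _ ↦ -(j : ℤ)) (fun _ ↦ ((0 : ℕ) : ℤ)) ∧ ψ.IsModulus T em ∧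
    (∀ w ∈ T, (em w : ℤ) ≤ FractionalIdeal.count K w (𝔪₀ : FractionalIdeal (𝓞 K)⁰ K)) ∧
    (∀ w : HeightOneSpectrum (𝓞 K), w ∉ S → w ≠ vbar → ψ.IsUnramifiedAt w))

include hvbar hopen hray hν he hf hvp hw₀ hιv h𝔪₀ hv𝔪₀ hw𝔪₀ hsupp hψ in
/-- ★ **`∫ 𝟙_{τ·Gal(K̄/K(𝔣′v^{n+1}))} dν = 0`** for `𝔣′ ≠ 0`, `𝔣′ ⊆ 𝔪₀`, `𝔣′` supported on `S ∪ {v̄}`, every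
`τ ∈ Γ_K` and every `n`: on `τ·Gal(K̄/K(𝔪₀))` the avatar `r_j` of `ψ_j` is EXACTLY `r_j(τ)·(e(κ_v(τ⁻¹σ)))^{−j}`
(A2), so by §1 the unit moments `j ≥ m₀` of `𝟙_{τGal(K̄/K(𝔣′))}·ν` along `z_τ` vanish; then 2γ = brick 1 and I §3.
[cite: deShalit1987, II.4.12 Remark (iv) (p. 67), II.4.17 (p. 77–78)]
[cite: Washington1997, §7.2] -/
theorem integral_ite_mem_absRayAdicTower_eq_zero {𝔣' : Ideal (𝓞 K)} (h𝔣' : 𝔣' ≠ ⊥) (hle : 𝔣' ≤ 𝔪₀)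
    (hv' : ¬ 𝔣' ≤ v.asIdeal)
    (hsupp' : ∀ w : HeightOneSpectrum (𝓞 K), 𝔣' ≤ w.asIdeal → w ∈ S ∨ w = vbar)
    (τ : absoluteGaloisGroup K) (n : ℕ) :
    ν.integral (fun σ ↦ if τ⁻¹ * σ ∈ (absRayAdicTower h𝔣' v).U n then (1 : ℂ_[p]) else 0) = 0 := by
  set e := padicIntEquivOfDegreeOne K p v he hf with hedef
  -- the coordinate and the weight
  set z : absoluteGaloisGroup K → ℤ_[p] := fun σ ↦
    if h' : τ⁻¹ * σ ∈ (absRestrictNormalHom (rayClassField K 𝔪₀)).ker then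
      e (((rayAdicCharacter h𝔪₀ hv𝔪₀ hw𝔪₀ ⟨τ⁻¹ * σ, h'⟩)⁻¹ : (v.adicCompletionIntegers K)ˣ) :
        v.adicCompletionIntegers K) else 0 with hzdef
  set w : absoluteGaloisGroup K → ℂ_[p] := fun σ ↦
    if τ⁻¹ * σ ∈ (absRestrictNormalHom (rayClassField K 𝔣')).ker then (1 : ℂ_[p]) else 0 with hwdef
  have hsupp₀ : ∀ w : HeightOneSpectrum (𝓞 K), w ∉ S → ((p : ℕ) : 𝓞 K) ∉ w.asIdeal → ¬ 𝔪₀ ≤ w.asIdeal := by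
    intro w hwS hwp hle'
    rcases hsupp w hle' with h | h
    · exact hwS h
    · exact hwp (h ▸ hvbar)
  have hS' : ∀ w : HeightOneSpectrum (𝓞 K), w ∉ S → ((p : ℕ) : 𝓞 K) ∉ w.asIdeal → ¬ 𝔣' ≤ w.asIdeal := by
    intro w hwS hwp h
    rcases hsupp' w h with h1 | h1
    · exact hwS h1
    · exact hwp (h1 ▸ hvbar)
  have hz : 𝒰.IsTowerContinuous z := isTowerContinuous_coord h𝔪₀ hv𝔪₀ hw𝔪₀ e hsupp₀ hvp hopen hray τ
  -- the weight is tower-continuous: `ker res_{K(𝔣′)}` contains some level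
  have hrayG : (DeShalit1987.rayKer K p S : Set (absoluteGaloisGroup K)) ⊆
      (absRestrictNormalHom (rayClassField K 𝔣')).ker :=
    SetLike.coe_subset_coe.mpr (DeShalit1987.rayKer_le_ker_absRestrictNormalHom_rayClassField p S h𝔣' hS')
  obtain ⟨N, hN⟩ := 𝒰.exists_subset_of_isOpen hopen hray (isOpen_ker_absRestrictNormalHom _) hrayG
  have hwc : 𝒰.IsTowerContinuous w := by
    rw [hwdef]
    convert isTowerContinuous_ite_mem_leftCoset (𝕜 := ℂ_[p]) (SetLike.coe_subset_coe.mp hN) τ using 3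
  have hw1 : ∀ σ, ‖w σ‖ ≤ 1 := fun σ ↦ by
    simp only [hwdef]; split_ifs <;> simp
  -- the unit moments vanish
  have hm : ∀ j : ℕ, m₀ ≤ j →
      ν.integral (fun σ ↦ (if IsUnit (z σ) then (1 : ℂ_[p]) else 0) * padicIntCast ℂ_[p] (z σ) ^ j * w σ) = 0 := by
    intro j hj
    obtain ⟨ψ, T, em, hψinf, hmod, hleT, hψunr⟩ := hψ j hj
    obtain ⟨r, hr⟩ := exists_isPAdicAvatarOf ι hψinf
    -- the coset integral `∫ w·r dν = 0` (§1)
    have h1 := integral_ite_mem_mul_avatar_eq_zero ι hvbar hopen hray ν m₀ hν h𝔣' hsupp' hj hψinf hψunr hr τ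
    -- on `τ·Gal(K̄/K(𝔪₀))`: `r(τ⁻¹σ) = (e κ(τ⁻¹σ))^{-j}` exactly (A2)
    have hA2 : ∀ (σ : absoluteGaloisGroup K) (hσ : τ⁻¹ * σ ∈ (absRestrictNormalHom (rayClassField K 𝔪₀)).ker),
        avatarValueAt r (τ⁻¹ * σ) =
          padicIntCast ℂ_[p] (e (rayAdicCharacter h𝔪₀ hv𝔪₀ hw𝔪₀ ⟨τ⁻¹ * σ, hσ⟩ : v.adicCompletionIntegers K)) ^
            (-(j : ℤ)) :=
      fun σ hσ ↦ avatarValueAt_eq_padicIntCast_zpow_of_type ι hψinf hmod hr hleT h𝔪₀ hv𝔪₀ hw𝔪₀ he hf hvp hw₀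
        (by simp) hιv hσ
    have hrτ : avatarValueAt r τ ≠ 0 := fun h ↦ by
      have := norm_avatarValueAt_eq_one r τ; rw [h, norm_zero] at this; exact zero_ne_one this
    -- pointwise: the moment integrand is `r(τ)⁻¹ · (w·r)`
    have hpt : ∀ σ, (if IsUnit (z σ) then (1 : ℂ_[p]) else 0) * padicIntCast ℂ_[p] (z σ) ^ j * w σ =
        (avatarValueAt r τ)⁻¹ *
          ((if τ⁻¹ * σ ∈ (absRestrictNormalHom (rayClassField K 𝔣')).ker then (1 : ℂ_[p]) else 0) *
            avatarValueAt r σ) := by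
      intro σ
      by_cases hG : τ⁻¹ * σ ∈ (absRestrictNormalHom (rayClassField K 𝔣')).ker
      · have hH : τ⁻¹ * σ ∈ (absRestrictNormalHom (rayClassField K 𝔪₀)).ker :=
          ker_absRestrictNormalHom_rayClassField_anti h𝔣' hle hG
        have hw' : w σ = 1 := by simp only [hwdef, if_pos hG]
        rw [hw', mul_one, if_pos hG, one_mul, if_pos (isUnit_coord h𝔪₀ hv𝔪₀ hw𝔪₀ e τ σ hH),
          one_mul, hzdef, padicIntCast_coord h𝔪₀ hv𝔪₀ hw𝔪₀ e τ σ hH, inv_pow, ← zpow_natCast, ← zpow_neg,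
          ← hA2 σ hH]
        have e1 : σ = τ * (τ⁻¹ * σ) := by group
        conv_rhs => rw [e1, avatarValueAt_mul]
        rw [← mul_assoc, inv_mul_cancel₀ hrτ, one_mul]
      · have hw' : w σ = 0 := by simp only [hwdef, if_neg hG]
        rw [hw', mul_zero, if_neg hG, zero_mul, mul_zero]
    rw [ν.integral_congr hpt, ν.integral_const_mul _ ?_, h1, mul_zero]
    -- tower-continuity of `w·r`
    have hψunr' : ∀ w : HeightOneSpectrum (𝓞 K), w ∉ S → ((p : ℕ) : 𝓞 K) ∉ w.asIdeal → ψ.IsUnramifiedAt w :=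
      fun w hwS hwp ↦ hψunr w hwS fun h ↦ hwp (h ▸ hvbar)
    exact hwc.mul (DeShalit1987.isTowerContinuous_avatarValueAt (hr.isPAdicAvatarOutside S) hψunr' hopen hray)
      hw1 (fun σ ↦ (norm_avatarValueAt_eq_one r σ).le)
  -- brick 1 through the push-forward (2γ): vanishing on the unit cell `≡ 1 (p^{n+1})`
  have h2 := ν.integral_ite_toZModPow_comp_mul_eq_zero_of_forall_le w hz hwc zero_le_one hw1 m₀ hm
    (Nat.succ_le_succ (Nat.zero_le n)) (a := (1 : ZMod (p ^ (n + 1)))) isUnit_one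
  refine (ν.integral_congr fun σ ↦ ?_).trans h2
  exact ite_mem_absRayAdicTower_eq h𝔪₀ hv𝔪₀ hw𝔪₀ e h𝔣' hle hv' τ σ n

/-! ### §3. Vanishing on every cell, and the uniqueness theorem -/
include hvbar hopen hray hν he hf hvp hw₀ hιv h𝔪₀ hv𝔪₀ hw𝔪₀ hsupp hψ in
/-- ★★ **`ν = 0` on every cell of the tower** when moreover `rayKer K p S ≤ U_n` for all `n`, `v ∉ S`,
`v ≠ v̄` and `v·v̄ ⊆ (p)` (split): each `U_N` is open and contains `rayKer`, hence some
`Gal(K̄/K(𝔪_S^m)) ⊇ Gal(K̄/K(𝔣′v^m))` with `𝔣′ = 𝔪₀(𝔤v̄)^m ⊆ 𝔪₀` supported on `S ∪ {v̄}`; the cell is a finite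
union of cosets of the latter (I §2), each of `ν`-integral `0` (§2).
[cite: deShalit1987, II.4.12 Remark (iv) (p. 67), II.4.16–4.17 (p. 76–78)] -/
theorem μ_eq_zero_of_forall_integral_avatar_eq_zero (hvS : v ∉ S) (hne : vbar ≠ v)
    (hp2 : v.asIdeal * vbar.asIdeal ≤ Ideal.span {((p : ℕ) : 𝓞 K)})
    (hray' : ∀ n, DeShalit1987.rayKer K p S ≤ 𝒰.U n) (N : ℕ) (a : absoluteGaloisGroup K ⧸ 𝒰.U N) :
    ν.μ N a = 0 := by
  -- a ray class subgroup inside `U_N`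
  obtain ⟨m, hm0, hm⟩ :=
    DeShalit1987.exists_ker_absRestrictNormalHom_rayClassField_le_of_rayKer_le p S (hopen N) (hray' N)
  set 𝔣' : Ideal (𝓞 K) := 𝔪₀ * ((∏ w ∈ S, w.asIdeal) * vbar.asIdeal) ^ m with h𝔣'def
  have h𝔣' : 𝔣' ≠ ⊥ := mul_ne_zero h𝔪₀ (DeShalit1987.prod_mul_pow_ne_bot S m)
  have hle : 𝔣' ≤ 𝔪₀ := Ideal.mul_le_right
  have hsupp' : ∀ w : HeightOneSpectrum (𝓞 K), 𝔣' ≤ w.asIdeal → w ∈ S ∨ w = vbar := by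
    intro w hw
    rcases (w.isPrime.mul_le).mp hw with h | h
    · exact hsupp w h
    · have h1 := w.isPrime.le_of_pow_le h
      rcases (w.isPrime.mul_le).mp h1 with h2 | h2
      · obtain ⟨w', hw'S, hw'⟩ := (w.isPrime.prod_le).mp h2
        have : w' = w := HeightOneSpectrum.ext (w'.isMaximal.eq_of_le w.isPrime.ne_top hw')
        exact Or.inl (this ▸ hw'S)
      · exact Or.inr (HeightOneSpectrum.ext (vbar.isMaximal.eq_of_le w.isPrime.ne_top h2)).symm
  have hv' : ¬ 𝔣' ≤ v.asIdeal := fun h ↦ by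
    rcases hsupp' v h with h1 | h1
    · exact hvS h1
    · exact hne h1.symm
  obtain ⟨k, rfl⟩ := Nat.exists_eq_succ_of_ne_zero hm0.ne'
  -- `W = Gal(K̄/K(𝔣′ v^{k+1})) ≤ Gal(K̄/C_{𝔪_S^{k+1}}) ≤ U_N`
  set W : Subgroup (absoluteGaloisGroup K) := (absRayAdicTower h𝔣' v).U k with hWdef
  have hWle : W ≤ 𝒰.U N := by
    refine le_trans ?_ hm
    refine DeShalit1987.absRayAdicTower_U_le_ker_rayClassField_of_le h𝔣' v ?_
    exact DeShalit1987.mul_pow_le_rayModulus_pow p S hp2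
      (J := 𝔣') (Ideal.mul_le_left) le_rfl
  -- `W` is open and contains `rayKer`, hence some level `U_M`
  have hsupp'' : ∀ w : HeightOneSpectrum (𝓞 K), w ∉ S → ((p : ℕ) : 𝓞 K) ∉ w.asIdeal →
      ¬ 𝔣' * v.asIdeal ^ (k + 1) ≤ w.asIdeal := by
    intro w hwS hwp hle'
    rcases (w.isPrime.mul_le).mp hle' with h | h
    · rcases hsupp' w h with h1 | h1
      · exact hwS h1
      · exact hwp (h1 ▸ hvbar)
    · have hvw : v = w := HeightOneSpectrum.ext (v.isMaximal.eq_of_le w.isPrime.ne_top (w.isPrime.le_of_pow_le h))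
      exact hwp (hvw ▸ hvp)
  have hrayW : (DeShalit1987.rayKer K p S : Set (absoluteGaloisGroup K)) ⊆ W :=
    SetLike.coe_subset_coe.mpr (DeShalit1987.rayKer_le_absRayAdicTower_U p S h𝔣' v hsupp'')
  obtain ⟨M, hM⟩ := 𝒰.exists_subset_of_isOpen hopen hray (isOpen_absRayAdicTower_U h𝔣' v k) hrayW
  haveI : W.FiniteIndex := (absRayAdicTower h𝔣' v).finiteIndex k
  exact μ_eq_zero_of_forall_integral_leftCoset_eq_zero ν hWle (SetLike.coe_subset_coe.mp hM)
    (fun τ ↦ integral_ite_mem_absRayAdicTower_eq_zero ι hvbar hopen hray ν m₀ hν he hf hvp hw₀ hιv h𝔪₀ hv𝔪₀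
      hw𝔪₀ hsupp hψ h𝔣' hle hv' hsupp' τ k) a

end Core

/-! ### §4. The uniqueness theorem -/

section Unique
variable (ι : PadicAlgCl p ≃+* ℂ) {v vbar : HeightOneSpectrum (𝓞 K)} {S : Finset (HeightOneSpectrum (𝓞 K))}
  (hvbar : ((p : ℕ) : 𝓞 K) ∈ vbar.asIdeal) (hvS : v ∉ S) (hne : vbar ≠ v)
  (hp2 : v.asIdeal * vbar.asIdeal ≤ Ideal.span {((p : ℕ) : 𝓞 K)})
  [v.asIdeal.LiesOver (ratPlace p).asIdeal]
  (he : v.asIdeal.ramificationIdx (𝓞 ℚ) = 1) (hf : v.asIdeal.inertiaDeg (𝓞 ℚ) = 1)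
  (hvp : ((p : ℕ) : 𝓞 K) ∈ v.asIdeal) {w₀ : InfinitePlace K} (hw₀ : ∀ w : InfinitePlace K, w = w₀)
  (hιv : ∀ d : 𝓞 K, d ∈ v.asIdeal ↔ ‖ι.symm (w₀.embedding (d : K))‖ < 1)
  {𝔪₀ : Ideal (𝓞 K)} (h𝔪₀ : 𝔪₀ ≠ ⊥) (hv𝔪₀ : ¬ 𝔪₀ ≤ v.asIdeal)
  (hw𝔪₀ : ∀ u : (𝓞 K)ˣ, (u : 𝓞 K) - 1 ∈ 𝔪₀ → u = 1)
  (hsupp : ∀ w : HeightOneSpectrum (𝓞 K), 𝔪₀ ≤ w.asIdeal → w ∈ S ∨ w = vbar) {m₀ : ℕ}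
  (hψ : ∀ j : ℕ, m₀ ≤ j → ∃ (ψ : HeckeCharacter K) (T : Finset (HeightOneSpectrum (𝓞 K)))
      (em : HeightOneSpectrum (𝓞 K) → ℕ),
    ψ.HasInfinityType (fun _ ↦ -(j : ℤ)) (fun _ ↦ ((0 : ℕ) : ℤ)) ∧ ψ.IsModulus T em ∧
    (∀ w ∈ T, (em w : ℤ) ≤ FractionalIdeal.count K w (𝔪₀ : FractionalIdeal (𝓞 K)⁰ K)) ∧
    (∀ w : HeightOneSpectrum (𝓞 K), w ∉ S → w ≠ vbar → ψ.IsUnramifiedAt w))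
  {𝒰 : SubgroupTower (absoluteGaloisGroup K)} (hopen : ∀ n, IsOpen (𝒰.U n : Set (absoluteGaloisGroup K)))
  (hray : ⋂ n, (𝒰.U n : Set (absoluteGaloisGroup K)) ⊆ DeShalit1987.rayKer K p S)
  (hray' : ∀ n, DeShalit1987.rayKer K p S ≤ 𝒰.U n)

include hvbar hvS hne hp2 he hf hvp hw₀ hιv h𝔪₀ hv𝔪₀ hw𝔪₀ hsupp hψ hopen hray hray' in
/-- ★★★ **UNIQUENESS OF THE `j = 0` MEASURE ON `Γ_K`**: two bounded distributions `μ, μ′` along the same tower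
`𝒰` of open subgroups (`⋂ U_n ⊆ rayKer K p S ≤ U_n`) whose integrals of the avatar of every in-range Hecke
character — type `(−m, 0)`, `m ≥ m₀`, unramified outside `S ∪ {v̄}`, avatar outside `S`, tower-continuous —
AGREE are EQUAL on every cell. (In the setting above: `K` with one infinite place, `v` of degree one the place of
`ι⁻¹∘σ_{w₀}`, `v ∉ S`, `v̄ ≠ v`, `v·v̄ ⊆ (p)`, the auxiliary modulus `𝔪₀` and characters `ψ_j`.)
[cite: deShalit1987, II.4.12 Remark (iv) (p. 67), II Thm. 4.14 (p. 71), II.4.17 (p. 77–78)] -/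
theorem μ_eq_of_forall_integral_avatar_eq (μ μ' : GroupDistribution 𝒰 ℂ_[p])
    (hint : ∀ (ε : HeckeCharacter K) (e : FramedGaloisRep K (PadicAlgCl p) 1) (m : ℕ),
      IsPAdicAvatarOutside S ι ε e → m₀ ≤ m →
      ε.HasInfinityType (fun _ ↦ -(m : ℤ)) (fun _ ↦ ((0 : ℕ) : ℤ)) →
      (∀ w : HeightOneSpectrum (𝓞 K), w ∉ S → w ≠ vbar → ε.IsUnramifiedAt w) →
      𝒰.IsTowerContinuous (fun σ ↦ avatarValueAt e σ) →
      μ.integral (fun σ ↦ avatarValueAt e σ) = μ'.integral (fun σ ↦ avatarValueAt e σ))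
    (N : ℕ) (a : absoluteGaloisGroup K ⧸ 𝒰.U N) : μ.μ N a = μ'.μ N a := by
  have h := μ_eq_zero_of_forall_integral_avatar_eq_zero ι hvbar hopen hray
    (GroupDistribution.add μ (GroupDistribution.smul (-1) μ')) m₀
    (fun ε e m hav hm hinf hunr htc ↦ integral_add_smul_neg_one_eq_zero μ μ' htc (hint ε e m hav hm hinf hunr htc))
    he hf hvp hw₀ hιv h𝔪₀ hv𝔪₀ hw𝔪₀ hsupp hψ hvS hne hp2 hray' N a
  rwa [add_smul_neg_one_μ, sub_eq_zero] at h

include hvbar hvS hne hp2 he hf hvp hw₀ hιv h𝔪₀ hv𝔪₀ hw𝔪₀ hsupp hψ hopen hray hray' in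
/-- **The same in the shape of the `(m, 0)`-identities**: if `μ` and `μ′` both satisfy, for every in-range
`(ε, e, m)` and EVERY entire continuation `hL` of `L(ε, s)`, `∫ ê dμ = R ε m hL` for one and the same
right-hand side `R` (e.g. `ι⁻¹(interpolationValue p v v̄ S ε m 0 Ω δ (hL.continuation 0))·Ω_p^m`, the clause of
the R3 endpoint), and `m₀ ≥ 1`, then `μ = μ′` on every cell — the continuation exists for type `(−m, 0)`,
`m ≥ 1` (`hasEntireContinuation_heckeLFunction_of_hasInfinityType`), so the two identities can be compared.
[cite: deShalit1987, II Thm. 4.14 (p. 71), II.4.12 Remark (iv) (p. 67)] [cite: TateThesis1967, Thm. 4.4.1] -/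
theorem μ_eq_of_forall_identity (hm₀ : 1 ≤ m₀) (μ μ' : GroupDistribution 𝒰 ℂ_[p])
    (R : (ε : HeckeCharacter K) → ℕ → LFunction.HasEntireContinuation (heckeLFunction ε) → ℂ_[p])
    (hμ : ∀ (ε : HeckeCharacter K) (e : FramedGaloisRep K (PadicAlgCl p) 1) (m : ℕ),
      IsPAdicAvatarOutside S ι ε e → m₀ ≤ m →
      ε.HasInfinityType (fun _ ↦ -(m : ℤ)) (fun _ ↦ ((0 : ℕ) : ℤ)) →
      (∀ w : HeightOneSpectrum (𝓞 K), w ∉ S → w ≠ vbar → ε.IsUnramifiedAt w) →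
      𝒰.IsTowerContinuous (fun σ ↦ avatarValueAt e σ) →
      ∀ hL : LFunction.HasEntireContinuation (heckeLFunction ε),
        μ.integral (fun σ ↦ avatarValueAt e σ) = R ε m hL)
    (hμ' : ∀ (ε : HeckeCharacter K) (e : FramedGaloisRep K (PadicAlgCl p) 1) (m : ℕ),
      IsPAdicAvatarOutside S ι ε e → m₀ ≤ m →
      ε.HasInfinityType (fun _ ↦ -(m : ℤ)) (fun _ ↦ ((0 : ℕ) : ℤ)) →
      (∀ w : HeightOneSpectrum (𝓞 K), w ∉ S → w ≠ vbar → ε.IsUnramifiedAt w) →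
      𝒰.IsTowerContinuous (fun σ ↦ avatarValueAt e σ) →
      ∀ hL : LFunction.HasEntireContinuation (heckeLFunction ε),
        μ'.integral (fun σ ↦ avatarValueAt e σ) = R ε m hL)
    (N : ℕ) (a : absoluteGaloisGroup K ⧸ 𝒰.U N) : μ.μ N a = μ'.μ N a := by
  refine μ_eq_of_forall_integral_avatar_eq ι hvbar hvS hne hp2 he hf hvp hw₀ hιv h𝔪₀ hv𝔪₀ hw𝔪₀ hsupp hψ hopen
    hray hray' μ μ' (fun ε e m hav hm hinf hunr htc ↦ ?_) N a
  have hL : LFunction.HasEntireContinuation (heckeLFunction ε) :=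
    HeckeCharacter.hasEntireContinuation_heckeLFunction_of_hasInfinityType hinf w₀ (by simp; omega) (by simp)
  rw [hμ ε e m hav hm hinf hunr htc hL, hμ' ε e m hav hm hinf hunr htc hL]

end Unique

end Summit.BirchSwinnertonDyer.BirchSwinnertonDyer.Theorems.PrintCf2.KatzJZeroUnique
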